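import Literature.NumberTheory.GaloisRepresentations.LubinTateColemanCoordDeltaTwo
import Literature.NumberTheory.GaloisRepresentations.LubinTateColemanTwoVariableTwistTwo
import HarnessLib

/-!
# Base change of the `Δ`-part: `S⟦Y⟧ = S⟦T⟧·1 ⊕ S⟦T⟧·σ_{−1}(1)` for every `(π)`-complete `𝒪_F`-algebra `S` — in particular the two-variable
# coordinate module `𝒪_F⟦X⟧⟦Y⟧` is free of rank ONE over `𝒪_F⟦X⟧⟦T⟧[Δ] = Λ(ℤ_p × ℤ₂^×)`, generated by `1` (de Shalit I §3.1, §3.7–3.8 (17), III §1.3)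

De Shalit, *Iwasawa theory of elliptic curves with complex multiplication* (1987), Ch. I §3.1 ("`ℤ_p⟦𝒢⟧ = Λ[Δ]`"), §3.7–3.8, Ch. III §1.3.
`LubinTateColemanCoordDeltaTwo` proved the one-variable statement (`𝒪_F⟦Y⟧ = Λ(Γ')·1 ⊕ Λ(Γ')·σ_{−1}(1)`, `σ_{−1}(1) = −ρ_{−1}`), and
`LubinTateColemanCoordFreeTwoVariable` the rank-two freeness of `S⟦Y⟧` over `S⟦T⟧` for the base-changed twist along any `ι : 𝒪_F → S`.  Here the
two are combined: the `𝒪_F⟦T⟧`-action base-changes (`map ι (c·r) = (map ι c)·(map ι r)`), so the rank-two coordinates `(a₁, b₁)` of `−ρ_{−1}` map to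
those of `−map ι ρ_{−1}` and `map ι b₁` is still a unit:

* ★ `LubinTate.map_mem_adicFiltGen_of_map`, `LubinTate.map_tPartial`, ★★ `LubinTate.map_tAct` (generic: **`map ι (c·r) = (map ι c)·(map ι r)`** whenever
  `D^S ∘ map ι = map ι ∘ D`), `map_tAct_twistLinear` (the Lubin–Tate twist: `twistLinearBase_map`);
* ★★★ `existsUnique_tAct_one_add_tAct_delta_base` — **every `G ∈ S⟦Y⟧` is UNIQUELY `a·1 + b·(−map ι ρ_{−1})`, `a, b ∈ S⟦T⟧`** (`S`
  `(ιπ)`-complete, `ιπ` a non-zero-divisor; `γ = 1 + π²w`); ★★★ `existsUnique_tAct_one_add_tAct_delta_C` — `S = 𝒪_F⟦X⟧`: **the two-variable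
  coordinate module `𝒪_F⟦X⟧⟦Y⟧` is `Λ·1 ⊕ Λ·σ_{−1}(1)`, `Λ = 𝒪_F⟦X⟧⟦T⟧`** — free of rank one over `Λ[Δ]`, the completed group ring of
  `ℤ_p × ℤ₂^× ≅ Gal(E_∞K_π^∞/F)` with coefficients in `𝒪_F`, generated by `1`: with g8's cyclic cokernel and the equivariances
  (`series_amice_frob`, `colemanTransform₂_galAct_eq`) this is de Shalit's «`𝒰_∞ ≅ Λ(𝒢)` up to pseudo-null» for one prime of the two-variable
  tower at `p = 2`, series side; `existsUnique_tAct_one_add_tAct_delta_integer` — the same on `PowerSeries (PowerSeries 𝒪_F)` (where `Col(β)` lives).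

Everything PROVED (0 sorry, no named facts, no new definitions).

## References

* E. de Shalit, *Iwasawa theory of elliptic curves with complex multiplication* (1987), Ch. I §3.1, §3.7–3.8 (17); Ch. III §1.3. [deShalit1987]
* L. C. Washington, *Introduction to Cyclotomic Fields*, 2nd ed. (1997), §13.2. [Washington1997]
-/

noncomputable section

open scoped PowerSeries.WithPiTopology

namespace Literature.NumberTheory.GaloisRepresentations

/-! ### Generic: the `S⟦T⟧`-action base-changes -/

namespace LubinTate

section MapTAct

open Finset

variable {S₀ S : Type*} [CommRing S₀] [CommRing S] (ι : S₀ →+* S) {p₀ : S₀}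
  {D₀ : PowerSeries S₀ →ₗ[S₀] PowerSeries S₀} (hD₀ : ∀ N (r : PowerSeries S₀), r ∈ adicFiltGen p₀ N → D₀ r ∈ adicFiltGen p₀ (N + 1))
  {D : PowerSeries S →ₗ[S] PowerSeries S} (hD : ∀ N (r : PowerSeries S), r ∈ adicFiltGen (ι p₀) N → D r ∈ adicFiltGen (ι p₀) (N + 1))
  (hcomp : ∀ r, D (PowerSeries.map ι r) = PowerSeries.map ι (D₀ r))

/-- `map ι (I_N(p₀)) ⊆ I_N(ι p₀)`. [cite: Washington1997, §13.2] -/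
theorem map_mem_adicFiltGen_of_map {N : ℕ} {V : PowerSeries S₀} (hV : V ∈ adicFiltGen p₀ N) :
    PowerSeries.map ι V ∈ adicFiltGen (ι p₀) N := fun k => by
  rw [PowerSeries.coeff_map]
  obtain ⟨c, hc⟩ := Ideal.mem_span_singleton'.mp (hV k)
  exact Ideal.mem_span_singleton'.mpr ⟨ι c, by rw [← map_pow, ← map_mul, hc]⟩

include hcomp in
/-- `D^k (map ι r) = map ι (D₀^k r)`. [cite: Washington1997, §13.2] -/
theorem iterate_map_eq (k : ℕ) (r : PowerSeries S₀) : (⇑D)^[k] (PowerSeries.map ι r) = PowerSeries.map ι ((⇑D₀)^[k] r) := by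
  induction k generalizing r with
  | zero => rfl
  | succ k ih => rw [Function.iterate_succ_apply, Function.iterate_succ_apply, hcomp, ih]

include hcomp in
/-- ★ `tPartial D (map ι c) (map ι r) K = map ι (tPartial D₀ c r K)`. [cite: Washington1997, §13.2] -/
theorem map_tPartial (c r : PowerSeries S₀) (K : ℕ) :
    tPartial D (PowerSeries.map ι c) (PowerSeries.map ι r) K = PowerSeries.map ι (tPartial D₀ c r K) := by
  rw [tPartial_def, tPartial_def, map_sum]
  exact sum_congr rfl fun k _ => by rw [PowerSeries.coeff_map, iterate_map_eq ι hcomp, map_mul, PowerSeries.map_C]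

include hcomp in
/-- ★★ **`map ι (c·r) = (map ι c)·(map ι r)`** — the `S₀⟦T⟧`-action on `S₀⟦Y⟧` and the `S⟦T⟧`-action on `S⟦Y⟧` are compatible along `map ι` whenever
the operators are (`D ∘ map ι = map ι ∘ D₀`). [cite: Washington1997, §13.2] -/
theorem map_tAct [IsAdicComplete (Ideal.span {p₀}) S₀] [IsAdicComplete (Ideal.span {ι p₀}) S] (c r : PowerSeries S₀) :
    PowerSeries.map ι (tAct D₀ hD₀ c r) = tAct D hD (PowerSeries.map ι c) (PowerSeries.map ι r) := by
  refine eq_tAct_of_forall_sub_mem hD fun K => ?_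
  rw [map_tPartial ι hcomp, ← map_sub]
  exact map_mem_adicFiltGen_of_map ι (tAct_sub_tPartial_mem hD₀ c r K)

end MapTAct

end LubinTate

section CoordDeltaTwoVariable

open GaloisRepresentations.IsNonarchimedeanLocalField LubinTate ValuativeRel Finset

variable {F : Type} [Field F] [ValuativeRel F] [TopologicalSpace F] [IsNonarchimedeanLocalField F]

attribute [local instance] ltNormUniformSpace ltNormIsUniformAddGroup rk1 nF nE fintypeResidueField

variable {π : 𝒪[F]} (hπ : (valuation F).IsUniformizer (π : F)) (hq : residueFieldCard F = 2)
variable {S : Type*} [CommRing S] (ι : LTCoeff F →+* S)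

/-- ★ **The Lubin–Tate `𝒪_F⟦T⟧`-action base-changes along `ι`**: `map ι (c·r) = (map ι c)·(map ι r)` for `T = D_γ` / `D_γ^{S}`.
[cite: deShalit1987, Ch. I §3.4 Lemma (ii), §3.8 (17)] -/
theorem map_tAct_twistLinear [IsAdicComplete (Ideal.span {ι (LTCoeff.of F π)}) S] (u : (LTCoeff F)ˣ)
    (hu : LTCoeff.of F π = residueFieldCard F * u) (γ : 𝒪[F]ˣ) (c r : PowerSeries (LTCoeff F)) :
    haveI := isAdicComplete_LTCoeff hπ
    PowerSeries.map ι (tAct (twistLinear hπ hq u γ) (twistLinear_mem_adicFiltGen_succ hπ hq u hu γ) c r) =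
      tAct (twistLinearBase hπ hq ι u γ) (twistLinearBase_mem_adicFiltGen_succ hπ hq ι u hu γ) (PowerSeries.map ι c) (PowerSeries.map ι r) := by
  haveI := isAdicComplete_LTCoeff hπ
  exact map_tAct ι (twistLinear_mem_adicFiltGen_succ hπ hq u hu γ) (twistLinearBase_mem_adicFiltGen_succ hπ hq ι u hu γ)
    (twistLinearBase_map hπ hq ι u γ) c r

/-! ### `S⟦Y⟧ = S⟦T⟧·1 ⊕ S⟦T⟧·σ_{−1}(1)` -/

/-- `σ_{−1}(1) = −map ι ρ_{−1}` for the base-changed twist (`C(ι(−1))·map ι ρ_{−1}·(1 ∘ [−1]) = −map ι ρ_{−1}`). [cite: deShalit1987, Ch. I §3.4 Lemma (ii)] -/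
theorem twistLinearBase_neg_one_one_add (u : (LTCoeff F)ˣ) :
    twistLinearBase hπ hq ι u (-1) 1 + 1 = -PowerSeries.map ι (evenPartTwo hπ hq (unitTwistSerTwo hπ (↑u⁻¹ : LTCoeff F) (-1))) := by
  have hs : PowerSeries.HasSubst (PowerSeries.map ι
      (hom (isLTRing_LTCoeff hπ) (isLTSeries_LTCoeff π) (isLTSeries_LTCoeff π) (LTCoeff.of F ((-1 : 𝒪[F]ˣ) : 𝒪[F])))) :=
    PowerSeries.HasSubst.of_constantCoeff_zero' (constantCoeff_map_unitHom hπ ι (-1))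
  rw [twistLinearBase_apply, sub_add_cancel, ← PowerSeries.coe_substAlgHom hs, map_one, mul_one, Units.val_neg, Units.val_one, map_neg, map_one,
    map_neg, map_one, map_neg, map_one, neg_one_mul]

/-- ★★★ **`S⟦Y⟧ = S⟦T⟧·1 ⊕ S⟦T⟧·σ_{−1}(1)`**: for `S` `(ιπ)`-adically complete with `ιπ` a non-zero-divisor and `γ = 1 + π²w` (`w` a unit), every
`G ∈ S⟦Y⟧` is UNIQUELY `a·1 + b·(−map ι ρ_{−1})` with `a, b ∈ S⟦T⟧` (the rank-two coordinates of `−ρ_{−1}` base-change by `map_tAct_twistLinear`, and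
their `Y`-component stays a unit). [cite: deShalit1987, Ch. I §3.1, §3.8 (17); Ch. III §1.3] -/
theorem existsUnique_tAct_one_add_tAct_delta_base [IsAdicComplete (Ideal.span {ι (LTCoeff.of F π)}) S]
    (hreg : ∀ x : S, ι (LTCoeff.of F π) * x = 0 → x = 0) (u : (LTCoeff F)ˣ) (hu : LTCoeff.of F π = residueFieldCard F * u) (γ w : 𝒪[F]ˣ)
    (hγ : (γ : 𝒪[F]) = 1 + π ^ 2 * w) (G : PowerSeries S) :
    ∃! ab : PowerSeries S × PowerSeries S,
      tAct (twistLinearBase hπ hq ι u γ) (twistLinearBase_mem_adicFiltGen_succ hπ hq ι u hu γ) ab.1 1 +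
        tAct (twistLinearBase hπ hq ι u γ) (twistLinearBase_mem_adicFiltGen_succ hπ hq ι u hu γ) ab.2
          (-PowerSeries.map ι (evenPartTwo hπ hq (unitTwistSerTwo hπ (↑u⁻¹ : LTCoeff F) (-1)))) = G := by
  haveI := isAdicComplete_LTCoeff hπ
  have hD := twistLinearBase_mem_adicFiltGen_succ hπ hq ι u hu γ
  -- the rank-two coordinates of `−ρ_{−1}` over `𝒪_F`, mapped to `S`
  obtain ⟨hex₀, -⟩ := exists_tAct_twistLinear_two_and_unique hπ hq u hu γ w hγ
  obtain ⟨a₁, b₁, h₁⟩ := hex₀ (-evenPartTwo hπ hq (unitTwistSerTwo hπ (↑u⁻¹ : LTCoeff F) (-1)))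
  have hb₁ : IsUnit (PowerSeries.map ι b₁) := (isUnit_snd_of_pair_eq_neg_rho hπ hq u hu γ w hγ h₁).map (PowerSeries.map ι)
  set e := -PowerSeries.map ι (evenPartTwo hπ hq (unitTwistSerTwo hπ (↑u⁻¹ : LTCoeff F) (-1))) with he
  have h₁' : tAct (twistLinearBase hπ hq ι u γ) hD (PowerSeries.map ι a₁) 1 +
      tAct (twistLinearBase hπ hq ι u γ) hD (PowerSeries.map ι b₁) PowerSeries.X = e := by
    have h := congrArg (PowerSeries.map ι) h₁
    rw [map_add, map_neg, map_tAct_twistLinear hπ hq ι u hu γ, map_tAct_twistLinear hπ hq ι u hu γ, map_one, PowerSeries.map_X] at h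
    exact h
  obtain ⟨b₁u, hb₁u⟩ := hb₁
  -- rank-two existence / uniqueness over `S`
  have hex : ∀ r : PowerSeries S, ∃ a b : PowerSeries S, tAct (twistLinearBase hπ hq ι u γ) hD a 1 +
      tAct (twistLinearBase hπ hq ι u γ) hD b PowerSeries.X = r := fun r => by
    obtain ⟨ab, hab, -⟩ := existsUnique_tAct_twistLinearBase hπ hq ι hreg u hu γ w hγ r
    exact ⟨ab.1, ab.2, hab⟩
  have huniq : ∀ a b a' b' : PowerSeries S, tAct (twistLinearBase hπ hq ι u γ) hD a 1 + tAct (twistLinearBase hπ hq ι u γ) hD b PowerSeries.X =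
      tAct (twistLinearBase hπ hq ι u γ) hD a' 1 + tAct (twistLinearBase hπ hq ι u γ) hD b' PowerSeries.X → a = a' ∧ b = b' := by
    intro a b a' b' h
    obtain ⟨ab, -, hu'⟩ := existsUnique_tAct_twistLinearBase hπ hq ι hreg u hu γ w hγ
      (tAct (twistLinearBase hπ hq ι u γ) hD a' 1 + tAct (twistLinearBase hπ hq ι u γ) hD b' PowerSeries.X)
    have e1 := (hu' (a, b) h).trans (hu' (a', b') rfl).symm
    exact ⟨congrArg Prod.fst e1, congrArg Prod.snd e1⟩
  obtain ⟨a, b, hr⟩ := hex G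
  have hce : ∀ c : PowerSeries S, tAct (twistLinearBase hπ hq ι u γ) hD c e =
      tAct (twistLinearBase hπ hq ι u γ) hD (c * PowerSeries.map ι a₁) 1 +
        tAct (twistLinearBase hπ hq ι u γ) hD (c * PowerSeries.map ι b₁) PowerSeries.X := fun c => by
    rw [← h₁', tAct_add_right, tAct_mul, tAct_mul]
  refine ⟨(a - b * ↑b₁u⁻¹ * PowerSeries.map ι a₁, b * ↑b₁u⁻¹), ?_, fun ab hab => ?_⟩
  · change tAct (twistLinearBase hπ hq ι u γ) hD (a - b * ↑b₁u⁻¹ * PowerSeries.map ι a₁) 1 +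
      tAct (twistLinearBase hπ hq ι u γ) hD (b * ↑b₁u⁻¹) e = G
    rw [hce, ← hr, tAct_sub_left, show b * ↑b₁u⁻¹ * PowerSeries.map ι b₁ = b by rw [← hb₁u, Units.inv_mul_cancel_right]]
    ring
  · have hab' : tAct (twistLinearBase hπ hq ι u γ) hD (ab.1 + ab.2 * PowerSeries.map ι a₁) 1 +
        tAct (twistLinearBase hπ hq ι u γ) hD (ab.2 * PowerSeries.map ι b₁) PowerSeries.X = G := by
      rw [← hab, hce, tAct_add_left]; ring
    have hc := huniq (ab.1 + ab.2 * PowerSeries.map ι a₁) (ab.2 * PowerSeries.map ι b₁) a b (hab'.trans hr.symm)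
    have h2 : ab.2 = b * ↑b₁u⁻¹ := by rw [← hc.2, ← hb₁u, Units.mul_inv_cancel_right]
    have h1 : ab.1 = a - b * ↑b₁u⁻¹ * PowerSeries.map ι a₁ := by rw [← h2, ← hc.1]; ring
    exact Prod.ext h1 h2

/-- ★★★ **The two-variable coordinate module `𝒪_F⟦X⟧⟦Y⟧` is `Λ·1 ⊕ Λ·σ_{−1}(1)`, `Λ = 𝒪_F⟦X⟧⟦T⟧`** (`S = 𝒪_F⟦X⟧`, `ι = C`): every
`G ∈ PowerSeries (PowerSeries 𝒪_F)` is UNIQUELY `a·1 + b·σ_{−1}(1)` with `a, b ∈ 𝒪_F⟦X⟧⟦T⟧` — the target of the two-variable Coleman transform is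
free of rank ONE over `Λ[Δ]`, the Iwasawa algebra of `ℤ_p × ℤ₂^× ≅ Gal(E_∞·K_π^∞/F)` over `𝒪_F`, generated by `1` (de Shalit's «`𝒰_∞ ≅ Λ(𝒢)`» for
one prime of the two-variable tower at `p = 2`, series side, up to the cyclic cokernel of `LubinTateColemanTwoVariableCokernelTwo`).
[cite: deShalit1987, Ch. I §3.1, §3.8 (17); Ch. III §1.3] -/
theorem existsUnique_tAct_one_add_tAct_delta_C (u : (LTCoeff F)ˣ) (hu : LTCoeff.of F π = residueFieldCard F * u) (γ w : 𝒪[F]ˣ)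
    (hγ : (γ : 𝒪[F]) = 1 + π ^ 2 * w) (G : PowerSeries (PowerSeries (LTCoeff F))) :
    haveI := isAdicComplete_span_C_LTCoeff hπ
    ∃! ab : PowerSeries (PowerSeries (LTCoeff F)) × PowerSeries (PowerSeries (LTCoeff F)),
      tAct (twistLinearBase hπ hq (PowerSeries.C (R := LTCoeff F)) u γ)
          (twistLinearBase_mem_adicFiltGen_succ hπ hq (PowerSeries.C (R := LTCoeff F)) u hu γ) ab.1 1 +
        tAct (twistLinearBase hπ hq (PowerSeries.C (R := LTCoeff F)) u γ)
          (twistLinearBase_mem_adicFiltGen_succ hπ hq (PowerSeries.C (R := LTCoeff F)) u hu γ) ab.2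
          (-PowerSeries.map (PowerSeries.C (R := LTCoeff F)) (evenPartTwo hπ hq (unitTwistSerTwo hπ (↑u⁻¹ : LTCoeff F) (-1)))) = G := by
  haveI := isAdicComplete_span_C_LTCoeff hπ
  exact existsUnique_tAct_one_add_tAct_delta_base hπ hq PowerSeries.C (eq_zero_of_C_pi_mul_eq_zero hπ) u hu γ w hγ G

/-- ★★★ The same on the transform's ambient ring `PowerSeries (PowerSeries 𝒪_F)` (base `ι = C ∘ (LTCoeff.of F)⁻¹`): **`Col(β)` lives in
`Λ·1 ⊕ Λ·σ_{−1}(1)`, a free `Λ[Δ]`-module of rank one, `Λ = 𝒪_F⟦X⟧⟦T⟧`**. [cite: deShalit1987, Ch. I §3.1, §3.8 (17); Ch. III §1.3] -/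
theorem existsUnique_tAct_one_add_tAct_delta_integer (u : (LTCoeff F)ˣ) (hu : LTCoeff.of F π = residueFieldCard F * u) (γ w : 𝒪[F]ˣ)
    (hγ : (γ : 𝒪[F]) = 1 + π ^ 2 * w) (G : PowerSeries (PowerSeries 𝒪[F])) :
    haveI := isAdicComplete_span_C_integer hπ
    ∃! ab : PowerSeries (PowerSeries 𝒪[F]) × PowerSeries (PowerSeries 𝒪[F]),
      tAct (twistLinearBase hπ hq ((PowerSeries.C (R := 𝒪[F])).comp (LTCoeff.of F).symm.toRingHom) u γ)
          (twistLinearBase_mem_adicFiltGen_succ hπ hq ((PowerSeries.C (R := 𝒪[F])).comp (LTCoeff.of F).symm.toRingHom) u hu γ) ab.1 1 +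
        tAct (twistLinearBase hπ hq ((PowerSeries.C (R := 𝒪[F])).comp (LTCoeff.of F).symm.toRingHom) u γ)
          (twistLinearBase_mem_adicFiltGen_succ hπ hq ((PowerSeries.C (R := 𝒪[F])).comp (LTCoeff.of F).symm.toRingHom) u hu γ) ab.2
          (-PowerSeries.map ((PowerSeries.C (R := 𝒪[F])).comp (LTCoeff.of F).symm.toRingHom)
            (evenPartTwo hπ hq (unitTwistSerTwo hπ (↑u⁻¹ : LTCoeff F) (-1)))) = G := by
  haveI := isAdicComplete_span_C_integer hπ
  exact existsUnique_tAct_one_add_tAct_delta_base hπ hq _ (eq_zero_of_C_pi_mul_eq_zero_integer hπ) u hu γ w hγ G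

end CoordDeltaTwoVariable

end Literature.NumberTheory.GaloisRepresentations
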